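import Literature.NumberTheory.LFunctions.NicolasOmega
import Literature.NumberTheory.LFunctions.MertensConstant
import Mathlib.Analysis.PSeries
import HarnessLib

/-!
# Nicolas 1983, Thm. 3 (c): `log f(x) = Ω±(x^{-b})` if RH fails —
# discharge of `Nicolas1983_logf_omega`

Topic: `Literature/NumberTheory/LFunctions`. Pure proof file (nothing asserted). It discharges
the named fact `Literature.NumberTheory.LFunctions.Nicolas1983_logf_omega` of `NicolasMertensRH.lean`:

  if the Riemann hypothesis is false, there is `b ∈ (0, 1/2)` such that, for some `c > 0`, both
  `log f(x) ≤ -c x^{-b}` and `log f(x) ≥ c x^{-b}` hold for arbitrarily large `x`,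

where `f(x) = e^γ log θ(x) ∏_{p ≤ x} (1 - 1/p)` (`nicolasF`). The other two named facts of that
file (`Nicolas2012_logf_lower`, `Schoenfeld1976_theta`: explicit estimates *under* RH) are not
touched. The input is Nicolas's `Ω±`-theorem for the comparison function
`g(x) = c x^{-b} + γ + log log x + E(x) - A(x)` (`NicolasOmega.lean`,
`exists_nicolasFn_neg_of_zero` / `exists_nicolasFn_pos_of_zero`: Landau's theorem at a right-most
zero of `ζ(1+s)` off the line), `E(x) = (ψ(x) - x)/(x log x)`, `A(x) = ∑_{p ≤ x} -log(1 - 1/p)`.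

* `Ω₋` (`exists_log_nicolasF_le_of_zero`): immediate, since
  `log f(x) = γ + log log θ(x) - A(x) ≤ γ + log log x + E(x) - A(x) = g(x) - c x^{-b}`
  (`θ ≤ ψ` and concavity). This half was already in `NicolasOmega.lean`
  (`Nicolas1983_logf_omegaMinus`); here it is re-derived for the *same* `b` as the `Ω₊` half.
* `Ω₊` (`exists_log_nicolasF_ge_of_zero`) is **not** immediate: the passage from `g` back to
  `log f` loses `(θ(x) - x)²/(x² log x)` (second-order term of `log log`), which is `o(x^{-b})`
  only where `|θ(x) - x| = o(x^{1-b/2} (log x)^{1/2})`, and no such bound is available without a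
  zero-free half-plane (if `sup Re ρ = 1` it is even false). Nicolas's device (1983, §4,
  pp. 386–387, the function
  `y(x) = K(x) - x^{-b}` and the sign changes of `y'`) is run here in the following variational
  form. Put `P(x) = ∑_{p ≤ x} 1/p` (`Literature.NumberTheory.LFunctions.Mertens.primeRecipSum`), `u(x) = A(x) - P(x)`
  (increasing, `u(y) - u(x) ≤ 4/x`) and
  `K(x) = γ + log log x + (θ(x) - x)/(x log x) - P(x)` (`nicolasK`), which is **continuous**: the
  jumps `log p/(p log p)` and `1/p` at a prime cancel. From the `Ω±`-property of `g`
  (and `ψ - θ ≤ 2 √x log x`) one finds `x₁ < x₂ < x₃` beyond any bound with `y(x₁) < 0`,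
  `y(x₂) > 0`, `y(x₃) < 0` for `y(x) = K(x) - u(x₃) - c x^{-b}`. At a maximum point `x*` of the
  continuous `y` on `[x₁, x₃]` (interior, `y(x*) > 0`), `y` is differentiable from each side with
  one-sided derivatives `-(S∓ - T(x*))(log x* + 1)/(x*² log² x*)`, where `S₊ = θ(x*) - x*`,
  `S₋ = θ(x*-) - x*`, `T(x) = b c x^{1-b} log² x/(log x + 1)`; maximality forces
  `S₋ ≤ T(x*) ≤ S₊ ≤ S₋ + log x*`, so `0 ≤ θ(x*) - x* ≤ T(x*) + log x* = O(x*^{1-b} log x*)`. Then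
  `log log θ(x*) ≥ log log x* + S₊/(x* log x*) - 2 S₊²/(x*² log x*)` gives
  `log f(x*) ≥ K(x*) - u(x*) - O(x*^{-2b} log x*) ≥ c x*^{-b} - O(x*^{-2b} log x*) ≥ (c/2) x*^{-b}`.

**Results.** `exists_log_nicolasF_le_of_zero`, `exists_log_nicolasF_ge_of_zero` (for every zero
`s₀` of `Z₁(s) = s ζ(1+s)` (`zetaOne`) right-most on its horizontal line, every
`b ∈ (0, 1/2)` with `b > -Re s₀`, and every `c`); `Nicolas1983_thm3c`, the printed form of
Thm. 3 (c) (for every `b < 1/2` and every zero `ρ` of `ζ` with `Re ρ > 1 - b` — i.e. for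
every `1 - Θ < b < 1/2`, `Θ = sup Re ρ` — and every `c > 0`, both inequalities for arbitrarily
large `x`; via `exists_zero_right_of_zero`);
`Nicolas1983_logf_omega_pm` (`¬RH ⟹ ∃ b ∈ (0,1/2) ∀ c > 0 …`); the discharge
`Literature.NumberTheory.LFunctions.Nicolas1983_logf_omega_holds`; and the corollaries Nicolas draws: `f(x) < 1` and
`f(x) > 1` each for arbitrarily large `x` (`Nicolas1983_thm3c_sign`) and **Thm. 2 (b)**
(`Nicolas1983_thm2b`): if RH fails, `N/φ(N) > e^γ log log N` holds for infinitely many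
primorials `N = p#` and fails for infinitely many (`f(p) = e^γ log log N · φ(N)/N`,
`nicolasF_natCast_eq`).

## References

* J.-L. Nicolas, *Petites valeurs de la fonction d'Euler*, J. Number Theory 17 (1983), 375–388:
  Thm. 2 (b) and Thm. 3 (c) (p. 376); §2 Prop. 1, (5)–(6) (Taylor bounds for `log log θ`), (9)–(11)
  (`log f = U + u`); §4 Prop. 3 (`J(x) = Ω±(x^{-b})`, `1 - θ < b < 1/2`) and pp. 386–387 (the
  function `y(x) = K(x) - x^{-b}`, `Ω₊` for `log f`). [Nicolas1983]
* J.-L. Nicolas, Acta Arith. 155 (2012), 311–321, (1.10) (the statement as vendored).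
  [Nicolas2012]
-/

noncomputable section

open Filter Topology Set Finset

namespace Literature.NumberTheory.LFunctions

namespace Nicolas

/-! ### One-sided first-derivative tests -/

/-- If `f'(x) > 0` then `f(z) > f(x)` for `z > x` close to `x`. [folklore] -/
theorem eventually_nhdsGT_lt_of_hasDerivAt_pos {f : ℝ → ℝ} {d x : ℝ} (hf : HasDerivAt f d x)
    (hd : 0 < d) : ∀ᶠ z in 𝓝[>] x, f x < f z := by
  have ht : Tendsto (slope f x) (𝓝[≠] x) (𝓝 d) := hasDerivAt_iff_tendsto_slope.1 hf
  have h1 : ∀ᶠ z in 𝓝[≠] x, 0 < slope f x z := ht.eventually (lt_mem_nhds hd)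
  have h2 : ∀ᶠ z in 𝓝[>] x, 0 < slope f x z := h1.filter_mono (nhdsGT_le_nhdsNE x)
  filter_upwards [h2, self_mem_nhdsWithin] with z hz hzx
  rw [slope_def_field] at hz
  have hzx' : 0 < z - x := sub_pos.2 hzx
  have := (div_pos_iff_of_pos_right hzx').1 hz
  linarith

/-- If `f'(x) < 0` then `f(z) > f(x)` for `z < x` close to `x`. [folklore] -/
theorem eventually_nhdsLT_lt_of_hasDerivAt_neg {f : ℝ → ℝ} {d x : ℝ} (hf : HasDerivAt f d x)
    (hd : d < 0) : ∀ᶠ z in 𝓝[<] x, f x < f z := by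
  have ht : Tendsto (slope f x) (𝓝[≠] x) (𝓝 d) := hasDerivAt_iff_tendsto_slope.1 hf
  have h1 : ∀ᶠ z in 𝓝[≠] x, slope f x z < 0 := ht.eventually (gt_mem_nhds hd)
  have h2 : ∀ᶠ z in 𝓝[<] x, slope f x z < 0 := h1.filter_mono (nhdsLT_le_nhdsNE x)
  filter_upwards [h2, self_mem_nhdsWithin] with z hz hzx
  rw [slope_def_field] at hz
  have hzx' : z - x < 0 := sub_neg.2 hzx
  rcases div_neg_iff.1 hz with ⟨hnum, _⟩ | ⟨_, hden⟩
  · linarith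
  · linarith

/-! ### A second-order lower bound for `log log` -/

/-- **Second-order lower bound for `log log`** (the shape of Nicolas 1983, (6), for `θ(x) ≥ x`):
if `log x ≥ 1`, `y ≥ x` and `y - x ≤ x` then
`log log y ≥ log log x + (y - x)/(x log x) - 2 (y - x)²/(x² log x)`.
[cite: Nicolas1983, §2, (6)] -/
theorem loglog_ge_of_le {x y : ℝ} (hx1 : 1 < x) (hx : 1 ≤ Real.log x) (hxy : x ≤ y)
    (hyx : y - x ≤ x) :
    Real.log (Real.log x) + (y - x) / (x * Real.log x) - 2 * (y - x) ^ 2 / (x ^ 2 * Real.log x)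
      ≤ Real.log (Real.log y) := by
  have hx0 : 0 < x := by linarith
  -- `log(1 + t) ≥ 2t/(t+2) ≥ t - t²` for `t ≥ 0` (Mathlib's `Real.le_log_one_add_of_nonneg`)
  have key : ∀ t : ℝ, 0 ≤ t → t - t ^ 2 ≤ Real.log (1 + t) := fun t ht ↦ by
    refine le_trans ?_ (Real.le_log_one_add_of_nonneg ht)
    rw [le_div_iff₀ (by linarith)]
    nlinarith [sq_nonneg t, mul_nonneg ht (sq_nonneg t)]
  set ℓ := Real.log x with hℓ
  have hℓ0 : 0 < ℓ := by linarith
  set u := (y - x) / x with hu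
  have hu0 : 0 ≤ u := div_nonneg (by linarith) hx0.le
  have hu1 : u ≤ 1 := (div_le_one hx0).2 hyx
  have hyx' : y = x * (1 + u) := by rw [hu]; field_simp; ring
  have hy0 : 0 < y := by linarith
  -- `v = log y - log x = log (1 + u) ∈ [u - u², u]`
  set v := Real.log y - ℓ with hv
  have hv_eq : v = Real.log (1 + u) := by
    rw [hv, hyx', Real.log_mul hx0.ne' (by linarith), hℓ]; ring
  have hv_lo : u - u ^ 2 ≤ v := hv_eq ▸ key u hu0
  have hv_hi : v ≤ u := by
    rw [hv_eq]
    have := Real.add_one_le_exp u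
    calc Real.log (1 + u) ≤ Real.log (Real.exp u) := Real.log_le_log (by linarith) (by linarith)
      _ = u := Real.log_exp u
  have hv0 : 0 ≤ v := le_trans (by nlinarith) hv_lo
  -- `log log y - log log x = log (1 + v/ℓ) ≥ v/ℓ - v²/ℓ²`
  have hlogy : Real.log y = ℓ * (1 + v / ℓ) := by rw [hv]; field_simp; ring
  have hw0 : 0 ≤ v / ℓ := div_nonneg hv0 hℓ0.le
  have hstep : Real.log (Real.log y) = Real.log ℓ + Real.log (1 + v / ℓ) := by
    rw [hlogy, Real.log_mul hℓ0.ne' (by linarith)]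
  have hlo2 := key (v / ℓ) hw0
  -- assemble
  rw [hstep]
  have h1 : (y - x) / (x * ℓ) = u / ℓ := by rw [hu]; field_simp
  have h2 : 2 * (y - x) ^ 2 / (x ^ 2 * ℓ) = 2 * u ^ 2 / ℓ := by rw [hu]; field_simp
  rw [h1, h2]
  -- `v/ℓ - (v/ℓ)² ≥ (u - u²)/ℓ - u²/ℓ² ≥ u/ℓ - 2u²/ℓ`
  have h3 : (u - u ^ 2) / ℓ ≤ v / ℓ := div_le_div_of_nonneg_right hv_lo hℓ0.le
  have h4 : (v / ℓ) ^ 2 ≤ u ^ 2 / ℓ ^ 2 := by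
    rw [div_pow]
    exact div_le_div_of_nonneg_right (pow_le_pow_left₀ hv0 hv_hi 2) (by positivity)
  have h5 : u ^ 2 / ℓ ^ 2 ≤ u ^ 2 / ℓ :=
    div_le_div_of_nonneg_left (sq_nonneg u) hℓ0 (by nlinarith)
  have h6 : (u - u ^ 2) / ℓ = u / ℓ - u ^ 2 / ℓ := by rw [sub_div]
  have h7 : 2 * u ^ 2 / ℓ = u ^ 2 / ℓ + u ^ 2 / ℓ := by ring
  linarith

/-! ### Sums over the primes `p ≤ n`: one step -/

/-- `∑_{p ≤ n+1} f(p) = ∑_{p ≤ n} f(p) + [n+1 prime] f(n+1)`. [folklore] -/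
theorem sum_primesLE_succ (f : ℕ → ℝ) (n : ℕ) :
    ∑ p ∈ Nat.primesLE (n + 1), f p =
      (∑ p ∈ Nat.primesLE n, f p) + if (n + 1).Prime then f (n + 1) else 0 := by
  rw [Nat.primesLE_succ]
  split_ifs with h
  · rw [Finset.sum_insert (Nat.notMem_primesLE n), add_comm]
  · simp

/-- `θ(n+1) = θ(n) + [n+1 prime] log(n+1)`. [folklore] -/
theorem theta_natCast_succ (n : ℕ) :
    Chebyshev.theta ((n + 1 : ℕ) : ℝ) =
      Chebyshev.theta n + if (n + 1).Prime then Real.log ((n + 1 : ℕ) : ℝ) else 0 := by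
  rw [Chebyshev.theta_eq_sum_primesLE_log, Chebyshev.theta_eq_sum_primesLE_log]
  exact sum_primesLE_succ (fun p ↦ Real.log p) n

/-- `0 ≤ θ(n+1) - θ(n) ≤ log(n+1)`. [folklore] -/
theorem theta_natCast_succ_sub_le (n : ℕ) :
    Chebyshev.theta ((n + 1 : ℕ) : ℝ) - Chebyshev.theta n ≤ Real.log ((n + 1 : ℕ) : ℝ) := by
  rw [theta_natCast_succ]
  have : 0 ≤ Real.log ((n + 1 : ℕ) : ℝ) := Real.log_nonneg (by exact_mod_cast Nat.succ_pos n)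
  split_ifs <;> linarith

/-! ### `P(x) = ∑_{p ≤ x} 1/p` (`Literature.NumberTheory.LFunctions.Mertens.primeRecipSum`) and the defect `u(x) = A(x) - P(x)` -/

open Mertens (primeRecipSum)

/-- `P(n+1) = P(n) + [n+1 prime]/(n+1)`. [folklore] -/
theorem primeRecipSum_natCast_succ (n : ℕ) :
    primeRecipSum ((n + 1 : ℕ) : ℝ) =
      primeRecipSum n + if (n + 1).Prime then (((n + 1 : ℕ) : ℝ))⁻¹ else 0 := by
  simp only [Mertens.primeRecipSum, Nat.floor_natCast]
  exact sum_primesLE_succ (fun p ↦ (p : ℝ)⁻¹) n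

/-- **The jumps cancel**: `(θ(n+1) - θ(n))/((n+1) log(n+1)) = P(n+1) - P(n)` (`n ≥ 1`), i.e. at a
prime `p` the jump `log p` of `θ`, weighted by `1/(p log p)`, equals the jump `1/p` of `P`.
[cite: Nicolas1983, §2, (9)–(10)] -/
theorem theta_succ_sub_div_eq (n : ℕ) (hn : 1 ≤ n) :
    (Chebyshev.theta ((n + 1 : ℕ) : ℝ) - Chebyshev.theta n) /
        (((n + 1 : ℕ) : ℝ) * Real.log ((n + 1 : ℕ) : ℝ)) =
      primeRecipSum ((n + 1 : ℕ) : ℝ) - primeRecipSum n := by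
  rw [theta_natCast_succ, primeRecipSum_natCast_succ]
  have h2 : (2 : ℝ) ≤ ((n + 1 : ℕ) : ℝ) := by exact_mod_cast Nat.succ_le_succ hn
  have hlog : Real.log ((n + 1 : ℕ) : ℝ) ≠ 0 := (Real.log_pos (by linarith)).ne'
  have h0 : ((n + 1 : ℕ) : ℝ) ≠ 0 := by positivity
  split_ifs
  · simp only [add_sub_cancel_left]
    exact div_mul_cancel_right₀ hlog _
  · simp

/-- The defect `u(x) = A(x) - P(x) = ∑_{p ≤ x} (-log(1 - 1/p) - 1/p)` (Nicolas's `u`, up to the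
sign convention and the tail; `A = Literature.Nicolas.mertensLog`, `P = Literature.Mertens.primeRecipSum`; as a
sum over `range (⌊x⌋ + 1)` this is `Literature.NumberTheory.LFunctions.Mertens.mertensLog_sub_primeRecipSum`).
[cite: Nicolas1983, §2, (9)–(11)] -/
def mertensDefect (x : ℝ) : ℝ := mertensLog x - primeRecipSum x

/-- Auxiliary (proof-internal). [folklore] -/
theorem mertensDefect_eq_natCast_floor (x : ℝ) : mertensDefect x = mertensDefect ⌊x⌋₊ := by
  have hP : primeRecipSum x = primeRecipSum ⌊x⌋₊ := by simp [Mertens.primeRecipSum]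
  rw [mertensDefect, mertensDefect, mertensLog_eq_natCast_floor, hP]

/-- `u(n+1) = u(n) + [n+1 prime] (a_{n+1} - 1/(n+1))`. [folklore] -/
theorem mertensDefect_natCast_succ (n : ℕ) :
    mertensDefect ((n + 1 : ℕ) : ℝ) = mertensDefect n +
      if (n + 1).Prime then primeLogCoeff (n + 1) - (((n + 1 : ℕ) : ℝ))⁻¹ else 0 := by
  have hA : mertensLog ((n + 1 : ℕ) : ℝ) =
      mertensLog n + if (n + 1).Prime then primeLogCoeff (n + 1) else 0 := by
    rw [mertensLog_natCast, mertensLog_natCast, sum_primesLE_succ]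
    split_ifs with h
    · rw [primeLogCoeff_of_prime h]
    · rfl
  rw [mertensDefect, mertensDefect, hA, primeRecipSum_natCast_succ]
  split_ifs <;> ring

/-- `0 ≤ u(n+1) - u(n) ≤ 2/(n+1)²`. [folklore] -/
theorem mertensDefect_natCast_succ_sub (n : ℕ) :
    0 ≤ mertensDefect ((n + 1 : ℕ) : ℝ) - mertensDefect n ∧
      mertensDefect ((n + 1 : ℕ) : ℝ) - mertensDefect n ≤ 2 / ((n + 1 : ℕ) : ℝ) ^ 2 := by
  rw [mertensDefect_natCast_succ]
  split_ifs with h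
  · have h1 := inv_le_primeLogCoeff h
    have h2 := abs_primeLogCoeff_sub_inv_le h
    rw [abs_of_nonneg (by linarith)] at h2
    constructor <;> linarith
  · simp only [add_zero, sub_self, le_refl, true_and]
    positivity

/-- `u` is non-decreasing along the integers, with `u(M) - u(N) ≤ ∑_{N < k ≤ M} 2/k²`.
[folklore] -/
theorem mertensDefect_natCast_sub_le {N M : ℕ} (h : N ≤ M) :
    0 ≤ mertensDefect (M : ℝ) - mertensDefect N ∧
      mertensDefect (M : ℝ) - mertensDefect N ≤ ∑ k ∈ Finset.Ioc N M, 2 / (k : ℝ) ^ 2 := by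
  induction M, h using Nat.le_induction with
  | base => simp
  | succ M hNM ih =>
    obtain ⟨h1, h2⟩ := mertensDefect_natCast_succ_sub M
    rw [Finset.sum_Ioc_succ_top (by omega)]
    constructor <;> linarith [ih.1, ih.2]

/-- `u` is non-decreasing. [folklore] -/
theorem mertensDefect_mono {x y : ℝ} (hxy : x ≤ y) : mertensDefect x ≤ mertensDefect y := by
  rw [mertensDefect_eq_natCast_floor x, mertensDefect_eq_natCast_floor y]
  linarith [(mertensDefect_natCast_sub_le (Nat.floor_le_floor hxy)).1]

/-- **Tail of `u`**: `u(y) - u(x) ≤ 4/x` for `1 ≤ x ≤ y`. [cite: Nicolas1983, §2, (11)] -/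
theorem mertensDefect_sub_le {x y : ℝ} (hx : 1 ≤ x) (hxy : x ≤ y) :
    mertensDefect y - mertensDefect x ≤ 4 / x := by
  rw [mertensDefect_eq_natCast_floor x, mertensDefect_eq_natCast_floor y]
  have hNM : ⌊x⌋₊ ≤ ⌊y⌋₊ := Nat.floor_le_floor hxy
  refine (mertensDefect_natCast_sub_le hNM).2.trans ?_
  have h1 : ∑ k ∈ Finset.Ioc ⌊x⌋₊ ⌊y⌋₊, 2 / (k : ℝ) ^ 2 =
      2 * ∑ k ∈ Finset.Ioo ⌊x⌋₊ (⌊y⌋₊ + 1), ((k : ℝ) ^ 2)⁻¹ := by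
    rw [Finset.mul_sum]
    refine Finset.sum_congr (by ext k; simp) fun k _ ↦ ?_
    rw [div_eq_mul_inv]
  rw [h1]
  have h2 := sum_Ioo_inv_sq_le (α := ℝ) ⌊x⌋₊ (⌊y⌋₊ + 1)
  have hx0 : 0 < x := by linarith
  have h3 : x < (⌊x⌋₊ : ℝ) + 1 := Nat.lt_floor_add_one x
  have h4 : 2 / ((⌊x⌋₊ : ℝ) + 1) ≤ 2 / x := div_le_div_of_nonneg_left (by norm_num) hx0 h3.le
  calc 2 * ∑ k ∈ Finset.Ioo ⌊x⌋₊ (⌊y⌋₊ + 1), ((k : ℝ) ^ 2)⁻¹ ≤ 2 * (2 / ((⌊x⌋₊ : ℝ) + 1)) := by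
        gcongr
    _ ≤ 2 * (2 / x) := by gcongr
    _ = 4 / x := by ring

/-- `0 ≤ u`. [folklore] -/
theorem mertensDefect_nonneg (x : ℝ) : 0 ≤ mertensDefect x := by
  rw [mertensDefect_eq_natCast_floor]
  have := (mertensDefect_natCast_sub_le (Nat.zero_le ⌊x⌋₊)).1
  have h0 : mertensDefect ((0 : ℕ) : ℝ) = 0 := by
    rw [mertensDefect, mertensLog_natCast]
    simp [Mertens.primeRecipSum]
  rw [h0] at this
  simpa using this

/-! ### Nicolas's continuous function `K(x) = γ + log log x + (θ(x) - x)/(x log x) - P(x)` -/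

/-- `K(x) = γ + log log x + (θ(x) - x)/(x log x) - P(x)`: Nicolas's `U(x)` of (9)–(10) with
`log log θ(x)` linearised; `log f(x) = K(x) - u(x) - (second-order Taylor term)`. Unlike
`A`, `θ`, `P` separately, `K` is continuous (`continuousOn_nicolasK`).
[cite: Nicolas1983, §2, (7)–(10) and §4, p. 386 (`K`)] -/
def nicolasK (x : ℝ) : ℝ :=
  Real.eulerMascheroniConstant + Real.log (Real.log x) +
    (Chebyshev.theta x - x) / (x * Real.log x) - primeRecipSum x

/-- `g(x) = c x^{-b} + K(x) + (ψ(x) - θ(x))/(x log x) - u(x)` for `x ≥ 2`. [folklore] -/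
theorem nicolasFn_eq_nicolasK {b c x : ℝ} (hx : 2 ≤ x) :
    nicolasFn b c x = c * x ^ (-b) + nicolasK x +
      (Chebyshev.psi x - Chebyshev.theta x) / (x * Real.log x) - mertensDefect x := by
  rw [nicolasFn, psiError_of_two_le hx, nicolasK, mertensDefect]
  have hx0 : x ≠ 0 := by positivity
  have hl : Real.log x ≠ 0 := (Real.log_pos (by linarith)).ne'
  field_simp
  ring

/-- `0 ≤ (ψ(x) - θ(x))/(x log x) ≤ 2/√x` for `x ≥ 2`. [folklore] -/
theorem psi_sub_theta_div_bounds {x : ℝ} (hx : 2 ≤ x) :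
    0 ≤ (Chebyshev.psi x - Chebyshev.theta x) / (x * Real.log x) ∧
      (Chebyshev.psi x - Chebyshev.theta x) / (x * Real.log x) ≤ 2 / √x := by
  have hx0 : 0 < x := by linarith
  have hl : 0 < Real.log x := Real.log_pos (by linarith)
  have hden : 0 < x * Real.log x := mul_pos hx0 hl
  refine ⟨div_nonneg (sub_nonneg.2 (Chebyshev.theta_le_psi x)) hden.le, ?_⟩
  rw [div_le_div_iff₀ hden (Real.sqrt_pos.2 hx0)]
  have h1 := Chebyshev.psi_sub_theta_le (by linarith : (1 : ℝ) ≤ x)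
  have hsq : √x * √x = x := Real.mul_self_sqrt hx0.le
  have hs0 : 0 < √x := Real.sqrt_pos.2 hx0
  calc (Chebyshev.psi x - Chebyshev.theta x) * √x ≤ 2 * √x * Real.log x * √x :=
        mul_le_mul_of_nonneg_right h1 hs0.le
    _ = 2 * (√x * √x) * Real.log x := by ring
    _ = 2 * (x * Real.log x) := by rw [hsq]; ring

/-- If `g(x) < 0` for `g = nicolasFn b 0` then `K(x) < u(x)` (`x ≥ 2`). [folklore] -/
theorem nicolasK_lt_of_nicolasFn_neg {b x : ℝ} (hx : 2 ≤ x) (h : nicolasFn b 0 x < 0) :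
    nicolasK x < mertensDefect x := by
  rw [nicolasFn_eq_nicolasK hx] at h
  have := (psi_sub_theta_div_bounds hx).1
  linarith

/-- If `g(x) > 0` for `g = nicolasFn b (-c')` then `K(x) > c' x^{-b} - 2/√x + u(x)` (`x ≥ 2`).
[folklore] -/
theorem lt_nicolasK_of_nicolasFn_pos {b c' x : ℝ} (hx : 2 ≤ x) (h : 0 < nicolasFn b (-c') x) :
    c' * x ^ (-b) - 2 / √x + mertensDefect x < nicolasK x := by
  rw [nicolasFn_eq_nicolasK hx] at h
  have := (psi_sub_theta_div_bounds hx).2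
  linarith

/-- A prime's contribution to `K`, as a continuous function of `t ≥ p`:
`k_p(t) = log p/(t log t) - 1/p`, with `k_p(p) = 0`. [folklore] -/
def kTerm (p : ℕ) (t : ℝ) : ℝ := Real.log p / (t * Real.log t) - (p : ℝ)⁻¹

/-- `x ↦ k_p(max(x, p))` is continuous on `ℝ` (`p ≥ 2`). [folklore] -/
theorem continuous_kTerm_max {p : ℕ} (hp : 2 ≤ p) : Continuous fun x : ℝ ↦ kTerm p (max x p) := by
  have hp1 : (1 : ℝ) < p := by exact_mod_cast hp
  have h1 : Continuous fun x : ℝ ↦ max x (p : ℝ) := continuous_id.max continuous_const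
  have hne : ∀ x : ℝ, max x (p : ℝ) ≠ 0 := fun x ↦
    (lt_of_lt_of_le (by linarith) (le_max_right x (p : ℝ))).ne'
  have hlog : ∀ x : ℝ, Real.log (max x (p : ℝ)) ≠ 0 := fun x ↦
    (Real.log_pos (lt_of_lt_of_le hp1 (le_max_right x (p : ℝ)))).ne'
  unfold kTerm
  exact (continuous_const.div (h1.mul (h1.log hne)) fun x ↦ mul_ne_zero (hne x) (hlog x)).sub
    continuous_const

/-- **`K` as a finite sum of continuous functions**: for `1 < x` and `⌊x⌋ ≤ N`,
`K(x) = γ + log log x - 1/log x + ∑_{p ≤ N} k_p(max(x, p))` (the primes `p > x` contribute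
`k_p(p) = 0`). [folklore] -/
theorem nicolasK_eq_sum (N : ℕ) {x : ℝ} (hx1 : 1 < x) (hxN : ⌊x⌋₊ ≤ N) :
    nicolasK x = Real.eulerMascheroniConstant + Real.log (Real.log x) - (Real.log x)⁻¹ +
      ∑ p ∈ Nat.primesLE N, kTerm p (max x p) := by
  have hx0 : 0 < x := by linarith
  have hl : Real.log x ≠ 0 := (Real.log_pos hx1).ne'
  have hsub : Nat.primesLE ⌊x⌋₊ ⊆ Nat.primesLE N := Nat.primesLE_mono hxN
  have hzero : ∀ p ∈ Nat.primesLE N, p ∉ Nat.primesLE ⌊x⌋₊ → kTerm p (max x p) = 0 := by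
    intro p hpN hpx
    have hp := Nat.prime_of_mem_primesLE hpN
    have hxp : x ≤ p := by
      by_contra h
      push Not at h
      exact hpx (Nat.mem_primesLE.2 ⟨Nat.le_floor h.le, hp⟩)
    have hpl : Real.log p ≠ 0 := (Real.log_pos (by exact_mod_cast hp.one_lt)).ne'
    rw [max_eq_right hxp, kTerm, div_mul_cancel_right₀ hpl, sub_self]
  rw [← Finset.sum_subset hsub hzero]
  have hcongr : ∀ p ∈ Nat.primesLE ⌊x⌋₊,
      kTerm p (max x p) = Real.log p / (x * Real.log x) - (p : ℝ)⁻¹ := by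
    intro p hp
    have hpx : (p : ℝ) ≤ x :=
      (Nat.cast_le.2 (Nat.le_of_mem_primesLE hp)).trans (Nat.floor_le hx0.le)
    rw [max_eq_left hpx, kTerm]
  rw [Finset.sum_congr rfl hcongr, Finset.sum_sub_distrib, ← Finset.sum_div, nicolasK,
    Chebyshev.theta_eq_sum_primesLE, Mertens.primeRecipSum, sub_div,
    div_mul_cancel_left₀ hx0.ne']
  ring

/-- **`K` is continuous** on every `[a, b] ⊂ (1, ∞)`. [cite: Nicolas1983, §4, p. 386] -/
theorem continuousOn_nicolasK {a a' : ℝ} (ha : 1 < a) : ContinuousOn nicolasK (Icc a a') := by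
  set N := ⌊a'⌋₊
  have heq : EqOn nicolasK (fun x ↦ Real.eulerMascheroniConstant + Real.log (Real.log x) -
      (Real.log x)⁻¹ + ∑ p ∈ Nat.primesLE N, kTerm p (max x p)) (Icc a a') :=
    fun x hx ↦ nicolasK_eq_sum N (by linarith [hx.1]) (Nat.floor_le_floor hx.2)
  refine ContinuousOn.congr ?_ heq
  have hlog : ∀ x ∈ Icc a a', Real.log x ≠ 0 := fun x hx ↦
    (Real.log_pos (by linarith [hx.1])).ne'
  have hx0 : ∀ x ∈ Icc a a', x ≠ 0 := fun x hx ↦ by linarith [hx.1]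
  have hc1 : ContinuousOn (fun x ↦ Real.log x) (Icc a a') :=
    Real.continuousOn_log.mono fun x hx ↦ hx0 x hx
  have hc2 : ContinuousOn (fun x ↦ Real.log (Real.log x)) (Icc a a') := hc1.log hlog
  have hc3 : ContinuousOn (fun x ↦ (Real.log x)⁻¹) (Icc a a') := hc1.inv₀ hlog
  have hc4 : Continuous fun x : ℝ ↦ ∑ p ∈ Nat.primesLE N, kTerm p (max x p) :=
    continuous_finsetSum _ fun p hp ↦ continuous_kTerm_max (Nat.two_le_of_mem_primesLE hp)
  exact ((continuousOn_const.add hc2).sub hc3).add hc4.continuousOn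

/-! ### The frozen comparison function near a point and its derivative -/

/-- `Φ(z) = log log z + (θ₀ - z)/(z log z) - c z^{-b} + C`: the function `y = K - u₃ - c x^{-b}`
on an interval free of integers, where `θ` and `P` are constant. [cite: Nicolas1983, §4, p. 386
(`y'(x)`)] -/
def phiAux (b c θ₀ C : ℝ) (z : ℝ) : ℝ :=
  Real.log (Real.log z) + (θ₀ - z) / (z * Real.log z) - c * z ^ (-b) + C

/-- `Φ'(x) = -(θ₀ - x)(log x + 1)/(x² log² x) + b c x^{-b}/x`. [cite: Nicolas1983, §4, p. 386] -/
def phiDeriv (b c θ₀ x : ℝ) : ℝ :=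
  -(θ₀ - x) * (Real.log x + 1) / (x ^ 2 * Real.log x ^ 2) + b * c * (x ^ (-b) / x)

/-- `Φ` has derivative `Φ'` at every `x > 1`. [cite: Nicolas1983, §4, p. 386] -/
theorem hasDerivAt_phiAux {b c θ₀ C x : ℝ} (hx : 1 < x) :
    HasDerivAt (phiAux b c θ₀ C) (phiDeriv b c θ₀ x) x := by
  have hx0 : x ≠ 0 := by positivity
  have hl : Real.log x ≠ 0 := (Real.log_pos hx).ne'
  have h1 : HasDerivAt (fun z ↦ Real.log (Real.log z)) (x⁻¹ / Real.log x) x :=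
    (Real.hasDerivAt_log hx0).log hl
  have h2 : HasDerivAt (fun z ↦ (θ₀ - z) / (z * Real.log z))
      ((-1 * (x * Real.log x) - (θ₀ - x) * (1 * Real.log x + x * x⁻¹)) /
        (x * Real.log x) ^ 2) x := by
    have hn : HasDerivAt (fun z ↦ θ₀ - z) (-1) x := (hasDerivAt_id' x).const_sub θ₀
    have hd : HasDerivAt (fun z ↦ z * Real.log z) (1 * Real.log x + x * x⁻¹) x :=
      (hasDerivAt_id' x).mul (Real.hasDerivAt_log hx0)
    exact hn.div hd (mul_ne_zero hx0 hl)
  have h3 : HasDerivAt (fun z ↦ c * z ^ (-b)) (c * (-b * x ^ (-b - 1))) x :=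
    (Real.hasDerivAt_rpow_const (Or.inl hx0)).const_mul c
  have h : HasDerivAt (phiAux b c θ₀ C) (x⁻¹ / Real.log x +
      (-1 * (x * Real.log x) - (θ₀ - x) * (1 * Real.log x + x * x⁻¹)) / (x * Real.log x) ^ 2 -
      c * (-b * x ^ (-b - 1))) x := ((h1.add h2).sub h3).add_const C
  refine h.congr_deriv ?_
  rw [phiDeriv, Real.rpow_sub_one hx0]
  field_simp
  ring

/-- The threshold `T(x) = b c x^{1-b} log² x/(log x + 1)` (`x^{1-b}` written `x^{-b} · x`):
`Φ'(x) > 0 ⟺ θ₀ - x < T(x)`. [cite: Nicolas1983, §4, p. 386] -/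
def nicolasT (b c x : ℝ) : ℝ := b * c * x ^ (-b) * x * Real.log x ^ 2 / (Real.log x + 1)

/-- `Φ'(x) = (log x + 1)/(x² log² x) · (T(x) - (θ₀ - x))`. [folklore] -/
theorem phiDeriv_eq {b c θ₀ x : ℝ} (hx : 1 < x) :
    phiDeriv b c θ₀ x =
      (Real.log x + 1) / (x ^ 2 * Real.log x ^ 2) * (nicolasT b c x - (θ₀ - x)) := by
  have hx0 : x ≠ 0 := by positivity
  have hl0 : 0 < Real.log x := Real.log_pos hx
  have hl1 : Real.log x + 1 ≠ 0 := by linarith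
  rw [phiDeriv, nicolasT]
  field_simp
  ring

/-- Auxiliary (proof-internal). [folklore] -/
theorem phiDeriv_pos {b c θ₀ x : ℝ} (hx : 1 < x) (h : θ₀ - x < nicolasT b c x) :
    0 < phiDeriv b c θ₀ x := by
  have hx0 : 0 < x := by linarith
  have hl0 : 0 < Real.log x := Real.log_pos hx
  rw [phiDeriv_eq hx]
  exact mul_pos (div_pos (by linarith) (mul_pos (pow_pos hx0 2) (pow_pos hl0 2))) (by linarith)

/-- Auxiliary (proof-internal). [folklore] -/
theorem phiDeriv_neg {b c θ₀ x : ℝ} (hx : 1 < x) (h : nicolasT b c x < θ₀ - x) :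
    phiDeriv b c θ₀ x < 0 := by
  have hx0 : 0 < x := by linarith
  have hl0 : 0 < Real.log x := Real.log_pos hx
  rw [phiDeriv_eq hx]
  exact mul_neg_of_pos_of_neg (div_pos (by linarith) (mul_pos (pow_pos hx0 2) (pow_pos hl0 2)))
    (by linarith)

/-- `0 ≤ T(x) ≤ b c x^{-b} x log x` for `x > 1` (`b c ≥ 0`). [folklore] -/
theorem nicolasT_bounds {b c x : ℝ} (hbc : 0 ≤ b * c) (hx : 1 < x) :
    0 ≤ nicolasT b c x ∧ nicolasT b c x ≤ b * c * x ^ (-b) * x * Real.log x := by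
  have hx0 : 0 < x := by linarith
  have hl0 : 0 < Real.log x := Real.log_pos hx
  have hw : 0 < x ^ (-b) := Real.rpow_pos_of_pos hx0 _
  have hM : 0 ≤ b * c * x ^ (-b) * x := by positivity
  refine ⟨div_nonneg (mul_nonneg hM (sq_nonneg _)) (by linarith), ?_⟩
  rw [nicolasT, div_le_iff₀ (by linarith)]
  nlinarith [mul_nonneg hM hl0.le]

/-- `y(z) = K(z) - u₃ - c z^{-b}` is `Φ` with the values of `θ`, `P` at `z` frozen. [folklore] -/
theorem nicolasK_sub_eq_phiAux (b c u₃ z : ℝ) :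
    nicolasK z - u₃ - c * z ^ (-b) =
      phiAux b c (Chebyshev.theta z)
        (Real.eulerMascheroniConstant - primeRecipSum z - u₃) z := by
  rw [nicolasK, phiAux]
  ring

/-- `θ` and `P` only depend on `⌊z⌋`. [folklore] -/
theorem theta_primeRecipSum_of_floor_eq {z : ℝ} {k : ℕ} (h : ⌊z⌋₊ = k) :
    Chebyshev.theta z = Chebyshev.theta k ∧ primeRecipSum z = primeRecipSum k := by
  constructor
  · rw [Chebyshev.theta_eq_theta_coe_floor z, h]
  · simp only [Mertens.primeRecipSum, Nat.floor_natCast, h]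

/-- The largest integer `m` *strictly* below `x > 1`: `1 ≤ m < x ≤ m + 1`. [folklore] -/
theorem exists_nat_lt_le_succ {x : ℝ} (hx : 1 < x) :
    ∃ m : ℕ, 1 ≤ m ∧ (m : ℝ) < x ∧ x ≤ m + 1 := by
  refine ⟨⌈x⌉₊ - 1, ?_, ?_, ?_⟩
  · have : 1 < ⌈x⌉₊ := Nat.lt_ceil.2 (by exact_mod_cast hx)
    omega
  · have h1 : 1 ≤ ⌈x⌉₊ := Nat.one_le_iff_ne_zero.2 (Nat.ceil_pos.2 (by linarith)).ne'
    rw [Nat.cast_sub h1, Nat.cast_one]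
    linarith [Nat.ceil_lt_add_one (by linarith : (0 : ℝ) ≤ x)]
  · have h1 : 1 ≤ ⌈x⌉₊ := Nat.one_le_iff_ne_zero.2 (Nat.ceil_pos.2 (by linarith)).ne'
    rw [Nat.cast_sub h1, Nat.cast_one, sub_add_cancel]
    exact Nat.le_ceil x

/-- **Gluing from the left.** With `m < x ≤ m + 1` (`m ≥ 1`), the function `Φ` frozen at the
values `θ(m)`, `P(m)` (those of `θ`, `P` on `[m, x)`) takes at `x` the value `y(x)` — trivially
if `x < m + 1`, and by the cancellation of the jumps (`theta_succ_sub_div_eq`) if `x = m + 1`.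
[cite: Nicolas1983, §2, (9)–(10)] -/
theorem phiAux_left_eq {b c u₃ x : ℝ} {m : ℕ} (hm : 1 ≤ m) (hmx : (m : ℝ) < x)
    (hxm : x ≤ m + 1) :
    phiAux b c (Chebyshev.theta m) (Real.eulerMascheroniConstant - primeRecipSum m - u₃) x =
      nicolasK x - u₃ - c * x ^ (-b) := by
  rw [nicolasK_sub_eq_phiAux]
  rcases hxm.lt_or_eq with hlt | heq
  · have hfl : ⌊x⌋₊ = m := (Nat.floor_eq_iff (by linarith)).2 ⟨hmx.le, hlt⟩
    obtain ⟨h1, h2⟩ := theta_primeRecipSum_of_floor_eq hfl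
    rw [h1, h2]
  · have hx' : x = ((m + 1 : ℕ) : ℝ) := by rw [heq]; push_cast; ring
    have hglue := theta_succ_sub_div_eq m hm
    rw [← hx'] at hglue
    simp only [phiAux]
    have key : (Chebyshev.theta x - x) / (x * Real.log x) -
        (Chebyshev.theta m - x) / (x * Real.log x) =
        (Chebyshev.theta x - Chebyshev.theta m) / (x * Real.log x) := by ring
    linarith [hglue, key]

/-! ### `log f` in terms of `A` and `θ` -/

/-- `log f(x) = γ + log log θ(x) - A(x)` for `x ≥ 3`. [cite: Nicolas2012, (1.9)] -/
theorem log_nicolasF_eq {x : ℝ} (hx : 3 ≤ x) :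
    Real.log (LFunctions.nicolasF x) =
      Real.eulerMascheroniConstant + Real.log (Real.log (Chebyshev.theta x)) - mertensLog x := by
  have hθ1 : 1 < Chebyshev.theta x := LFunctions.one_lt_theta hx
  have hlogθ : 0 < Real.log (Chebyshev.theta x) := Real.log_pos hθ1
  have hprod : ∏ p ∈ Nat.primesLE ⌊x⌋₊, (1 - (p : ℝ)⁻¹) = Real.exp (-mertensLog x) := by
    rw [Real.exp_neg, mertensLog_eq_natCast_floor, exp_mertensLog_natCast,
      ← Finset.prod_inv_distrib]
    simp only [inv_inv]
  rw [LFunctions.nicolasF, hprod, Real.log_mul (mul_pos (Real.exp_pos _) hlogθ).ne' (Real.exp_pos _).ne',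
    Real.log_mul (Real.exp_pos _).ne' hlogθ.ne', Real.log_exp, Real.log_exp]
  ring

/-! ### The thresholds -/

/-- The four eventual conditions on `x` used below, for `0 < b < 1/2`, `c > 0`:
`x ≥ 9`; `x^{-b} log x ≤ c/(4(bc+1)²)`; `x^{-b} log x ≤ 1/(2(bc+1))`; `6/√x < c x^{-b}`.
[folklore] -/
theorem eventually_thresholds {b c : ℝ} (hb0 : 0 < b) (hb : b < 1 / 2) (hc : 0 < c) :
    ∀ᶠ x : ℝ in atTop, 9 ≤ x ∧ x ^ (-b) * Real.log x ≤ c / (4 * (b * c + 1) ^ 2) ∧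
      x ^ (-b) * Real.log x ≤ 1 / (2 * (b * c + 1)) ∧ 6 / √x < c * x ^ (-b) := by
  have hε₁ : 0 < c / (4 * (b * c + 1) ^ 2) := by positivity
  have hε₂ : 0 < 1 / (2 * (b * c + 1)) := by positivity
  have h1 := (isLittleO_log_rpow_atTop hb0).def hε₁
  have h2 := (isLittleO_log_rpow_atTop hb0).def hε₂
  have h3 := (tendsto_rpow_atTop (by linarith : (0 : ℝ) < 1 / 2 - b)).eventually_gt_atTop (6 / c)
  filter_upwards [eventually_ge_atTop (9 : ℝ), h1, h2, h3] with x hx h1 h2 h3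
  have hx0 : 0 < x := by linarith
  have hlog : 0 ≤ Real.log x := Real.log_nonneg (by linarith)
  rw [Real.norm_of_nonneg hlog, Real.norm_of_nonneg (Real.rpow_nonneg hx0.le _)] at h1 h2
  have hneg : x ^ (-b) = (x ^ b)⁻¹ := Real.rpow_neg hx0.le b
  have hb' : 0 < x ^ b := Real.rpow_pos_of_pos hx0 b
  refine ⟨hx, ?_, ?_, ?_⟩
  · rw [hneg, inv_mul_le_iff₀ hb']
    linarith
  · rw [hneg, inv_mul_le_iff₀ hb']
    linarith
  · have hsplit : x ^ (1 / 2 - b) = √x * x ^ (-b) := by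
      rw [Real.sqrt_eq_rpow, ← Real.rpow_add hx0]
      ring_nf
    rw [hsplit, div_lt_iff₀ hc] at h3
    have hsx : 0 < √x := Real.sqrt_pos.2 hx0
    rw [div_lt_iff₀ hsx]
    linarith

/-! ### The `Ω₊` half -/

/-- **Nicolas 1983, Thm. 3 (c), the `Ω₊` half** (for a given right-most zero). Let
`0 < b < 1/2`, let `s₀` be a zero of `Z₁(s) = s ζ(1+s)` (`zetaOne`) with `Re s₀ > -b` and no
zero of `Z₁` on the horizontal ray to its right, and let `c > 0`. Then `log f(x) ≥ c x^{-b}` for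
arbitrarily large `x`. [cite: Nicolas1983, Thm. 3 (c); §4 Prop. 3 and pp. 386–387] -/
theorem exists_log_nicolasF_ge_of_zero {b : ℝ} (hb0 : 0 < b) (hb : b < 1 / 2) {s₀ : ℂ}
    (hZ : zetaOne s₀ = 0) (hre : -b < s₀.re) (hray : ∀ t : ℝ, 0 < t → zetaOne (s₀ + t) ≠ 0)
    {c : ℝ} (hc : 0 < c) (X : ℝ) :
    ∃ x : ℝ, X < x ∧ c * x ^ (-b) ≤ Real.log (LFunctions.nicolasF x) := by
  -- thresholds, for the constant `c₁ = 2c`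
  set c₁ : ℝ := 2 * c with hc₁
  have hc₁0 : 0 < c₁ := by positivity
  obtain ⟨X₀, hX₀⟩ := Filter.eventually_atTop.1 (eventually_thresholds hb0 hb hc₁0)
  -- three points `x₁ < x₂ < x₃` with `g₀(x₁) < 0`, `g_{-2c₁}(x₂) > 0`, `g₀(x₃) < 0`
  obtain ⟨x₁, hx₁, hg₁⟩ := exists_nicolasFn_neg_of_zero hb0 hb hZ hre hray 0 (max X X₀)
  obtain ⟨x₂, hx₂, hg₂⟩ := exists_nicolasFn_pos_of_zero hb0 hb hZ hre hray (-(2 * c₁)) x₁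
  obtain ⟨x₃, hx₃, hg₃⟩ := exists_nicolasFn_neg_of_zero hb0 hb hZ hre hray 0 x₂
  have hX₁ : X₀ ≤ x₁ := le_trans (le_max_right _ _) hx₁.le
  have hXx₁ : X < x₁ := lt_of_le_of_lt (le_max_left _ _) hx₁
  obtain ⟨h9₁, -, -, -⟩ := hX₀ x₁ hX₁
  obtain ⟨h9₂, -, -, hE₂⟩ := hX₀ x₂ (by linarith)
  obtain ⟨h9₃, -, -, -⟩ := hX₀ x₃ (by linarith)
  -- the continuous function `y`
  set u₃ := mertensDefect x₃ with hu₃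
  set y : ℝ → ℝ := fun x ↦ nicolasK x - u₃ - c₁ * x ^ (-b) with hy
  have hy₁ : y x₁ < 0 := by
    have h1 := nicolasK_lt_of_nicolasFn_neg (by linarith) hg₁
    have h2 : mertensDefect x₁ ≤ u₃ := mertensDefect_mono (by linarith)
    have h3 : 0 < c₁ * x₁ ^ (-b) := mul_pos hc₁0 (Real.rpow_pos_of_pos (by linarith) _)
    simp only [hy]
    linarith
  have hy₃ : y x₃ < 0 := by
    have h1 := nicolasK_lt_of_nicolasFn_neg (by linarith) hg₃
    have h3 : 0 < c₁ * x₃ ^ (-b) := mul_pos hc₁0 (Real.rpow_pos_of_pos (by linarith) _)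
    simp only [hy]
    linarith
  have hy₂ : 0 < y x₂ := by
    have h1 := lt_nicolasK_of_nicolasFn_pos (by linarith) hg₂
    have h2 : u₃ - mertensDefect x₂ ≤ 4 / x₂ := mertensDefect_sub_le (by linarith) hx₃.le
    have hx₂0 : 0 < x₂ := by linarith
    have h4 : 4 / x₂ ≤ 4 / √x₂ := by
      refine div_le_div_of_nonneg_left (by norm_num) (Real.sqrt_pos.2 hx₂0) ?_
      have hs1 : 1 ≤ √x₂ := Real.one_le_sqrt.2 (by linarith)
      calc √x₂ = √x₂ * 1 := (mul_one _).symm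
        _ ≤ √x₂ * √x₂ := by gcongr
        _ = x₂ := Real.mul_self_sqrt hx₂0.le
    have h5 : 2 / √x₂ + 4 / √x₂ = 6 / √x₂ := by ring
    simp only [hy]
    linarith
  -- its maximum on `[x₁, x₃]`
  have hcont : ContinuousOn y (Icc x₁ x₃) := by
    refine ((continuousOn_nicolasK (by linarith)).sub continuousOn_const).sub ?_
    exact continuousOn_const.mul (continuousOn_id.rpow_const fun x hx ↦
      Or.inl (ne_of_gt (show (0 : ℝ) < id x by simp only [id_eq]; linarith [hx.1])))
  obtain ⟨xs, hxs, hmax⟩ :=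
    (isCompact_Icc (a := x₁) (b := x₃)).exists_isMaxOn (nonempty_Icc.2 (by linarith)) hcont
  have hy_xs : 0 < y xs :=
    lt_of_lt_of_le hy₂ (hmax (show x₂ ∈ Icc x₁ x₃ from ⟨by linarith, by linarith⟩))
  have hxs₁ : x₁ < xs := by
    rcases hxs.1.lt_or_eq with h | h
    · exact h
    · rw [← h] at hy_xs; linarith
  have hxs₃ : xs < x₃ := by
    rcases hxs.2.lt_or_eq with h | h
    · exact h
    · rw [h] at hy_xs; linarith
  obtain ⟨hxs9, hE1, hE2, -⟩ := hX₀ xs (by linarith)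
  have hxs0 : 0 < xs := by linarith
  have hxs1 : 1 < xs := by linarith
  have hlog1 : 1 ≤ Real.log xs := by
    rw [Real.le_log_iff_exp_le hxs0]
    have := Real.exp_one_lt_d9
    linarith
  have hl0 : 0 < Real.log xs := by linarith
  have hw0 : 0 < xs ^ (-b) := Real.rpow_pos_of_pos hxs0 _
  -- (R) right test: `T(xs) ≤ θ(xs) - xs`
  have hR : nicolasT b c₁ xs ≤ Chebyshev.theta xs - xs := by
    by_contra hcon
    push Not at hcon
    set n := ⌊xs⌋₊ with hn
    have hn1 : (n : ℝ) ≤ xs := Nat.floor_le hxs0.le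
    have hn2 : xs < n + 1 := Nat.lt_floor_add_one xs
    set Φ := phiAux b c₁ (Chebyshev.theta xs)
      (Real.eulerMascheroniConstant - primeRecipSum xs - u₃) with hΦ
    have hderiv : HasDerivAt Φ (phiDeriv b c₁ (Chebyshev.theta xs) xs) xs :=
      hasDerivAt_phiAux hxs1
    have hpos : 0 < phiDeriv b c₁ (Chebyshev.theta xs) xs := phiDeriv_pos hxs1 hcon
    have hev1 := eventually_nhdsGT_lt_of_hasDerivAt_pos hderiv hpos
    have hev2 : ∀ᶠ z in 𝓝[>] xs, z ∈ Ioo xs (min ((n : ℝ) + 1) x₃) :=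
      Ioo_mem_nhdsGT (lt_min hn2 hxs₃)
    obtain ⟨z, hz1, hz2⟩ := (hev1.and hev2).exists
    have hzn : z < (n : ℝ) + 1 := lt_of_lt_of_le hz2.2 (min_le_left _ _)
    have hz3 : z < x₃ := lt_of_lt_of_le hz2.2 (min_le_right _ _)
    have hzfl : ⌊z⌋₊ = n :=
      (Nat.floor_eq_iff (by linarith [hz2.1])).2 ⟨by linarith [hz2.1], hzn⟩
    obtain ⟨hθz, hPz⟩ := theta_primeRecipSum_of_floor_eq hzfl
    obtain ⟨hθs, hPs⟩ := theta_primeRecipSum_of_floor_eq hn.symm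
    have hyz : y z = Φ z := by
      simp only [hy, hΦ]
      rw [nicolasK_sub_eq_phiAux, hθz, hPz, ← hθs, ← hPs]
    have hys : y xs = Φ xs := by
      simp only [hy, hΦ]
      rw [nicolasK_sub_eq_phiAux]
    have hzmem : z ∈ Icc x₁ x₃ := ⟨by linarith [hz2.1], hz3.le⟩
    have hle : y z ≤ y xs := hmax hzmem
    rw [hyz, hys] at hle
    linarith
  -- (L) left test: `θ(xs) - xs ≤ T(xs) + log xs`
  have hL : Chebyshev.theta xs - xs ≤ nicolasT b c₁ xs + Real.log xs := by
    obtain ⟨m, hm1, hmx, hxm⟩ := exists_nat_lt_le_succ hxs1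
    -- the jump at `xs` is at most `log xs`
    have hjump : Chebyshev.theta xs - Chebyshev.theta m ≤ Real.log xs := by
      rcases hxm.lt_or_eq with hlt | heq
      · have hfl : ⌊xs⌋₊ = m := (Nat.floor_eq_iff hxs0.le).2 ⟨hmx.le, hlt⟩
        rw [(theta_primeRecipSum_of_floor_eq hfl).1, sub_self]
        exact hl0.le
      · have hx' : xs = ((m + 1 : ℕ) : ℝ) := by rw [heq]; push_cast; ring
        rw [hx']
        exact theta_natCast_succ_sub_le m
    by_contra hcon
    push Not at hcon
    have hcon' : nicolasT b c₁ xs < Chebyshev.theta m - xs := by linarith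
    set Φ := phiAux b c₁ (Chebyshev.theta m)
      (Real.eulerMascheroniConstant - primeRecipSum m - u₃) with hΦ
    have hderiv : HasDerivAt Φ (phiDeriv b c₁ (Chebyshev.theta m) xs) xs :=
      hasDerivAt_phiAux hxs1
    have hneg : phiDeriv b c₁ (Chebyshev.theta m) xs < 0 := phiDeriv_neg hxs1 hcon'
    have hev1 := eventually_nhdsLT_lt_of_hasDerivAt_neg hderiv hneg
    have hev2 : ∀ᶠ z in 𝓝[<] xs, z ∈ Ioo (max (m : ℝ) x₁) xs :=
      Ioo_mem_nhdsLT (max_lt hmx hxs₁)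
    obtain ⟨z, hz1, hz2⟩ := (hev1.and hev2).exists
    have hmz : (m : ℝ) < z := lt_of_le_of_lt (le_max_left _ _) hz2.1
    have hx₁z : x₁ < z := lt_of_le_of_lt (le_max_right _ _) hz2.1
    have hzfl : ⌊z⌋₊ = m :=
      (Nat.floor_eq_iff (by linarith)).2 ⟨hmz.le, by linarith [hz2.2]⟩
    obtain ⟨hθz, hPz⟩ := theta_primeRecipSum_of_floor_eq hzfl
    have hyz : y z = Φ z := by
      simp only [hy, hΦ]
      rw [nicolasK_sub_eq_phiAux, hθz, hPz]
    have hys : y xs = Φ xs := by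
      simp only [hy, hΦ]
      rw [phiAux_left_eq hm1 hmx hxm]
    have hzmem : z ∈ Icc x₁ x₃ := ⟨hx₁z.le, by linarith [hz2.2]⟩
    have hle : y z ≤ y xs := hmax hzmem
    rw [hyz, hys] at hle
    linarith
  -- size of `S = θ(xs) - xs`: `0 ≤ S ≤ (b c₁ + 1) x^{-b} x log x ≤ xs/2`
  have hwx : 1 ≤ xs ^ (-b) * xs := by
    rw [← Real.rpow_add_one hxs0.ne']
    exact Real.one_le_rpow hxs1.le (by linarith)
  obtain ⟨hT0, hT1⟩ := nicolasT_bounds (b := b) (c := c₁) (x := xs) (mul_pos hb0 hc₁0).le hxs1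
  have hS0 : 0 ≤ Chebyshev.theta xs - xs := le_trans hT0 hR
  have hbc1 : 0 < b * c₁ + 1 := by positivity
  have hS1 : Chebyshev.theta xs - xs ≤ (b * c₁ + 1) * (xs ^ (-b) * xs * Real.log xs) := by
    have h1 : Real.log xs ≤ xs ^ (-b) * xs * Real.log xs := by nlinarith
    calc Chebyshev.theta xs - xs ≤ nicolasT b c₁ xs + Real.log xs := hL
      _ ≤ b * c₁ * xs ^ (-b) * xs * Real.log xs + xs ^ (-b) * xs * Real.log xs := by linarith
      _ = (b * c₁ + 1) * (xs ^ (-b) * xs * Real.log xs) := by ring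
  have hq1 : (b * c₁ + 1) * (xs ^ (-b) * Real.log xs) ≤ 1 / 2 :=
    calc (b * c₁ + 1) * (xs ^ (-b) * Real.log xs)
        ≤ (b * c₁ + 1) * (1 / (2 * (b * c₁ + 1))) := by gcongr
      _ = 1 / 2 := by field_simp
  have hq2 : (b * c₁ + 1) ^ 2 * (xs ^ (-b) * Real.log xs) ≤ c₁ / 4 :=
    calc (b * c₁ + 1) ^ 2 * (xs ^ (-b) * Real.log xs)
        ≤ (b * c₁ + 1) ^ 2 * (c₁ / (4 * (b * c₁ + 1) ^ 2)) := by gcongr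
      _ = c₁ / 4 := by field_simp
  have hSx : Chebyshev.theta xs - xs ≤ xs / 2 := by
    have h := mul_le_mul_of_nonneg_left hq1 hxs0.le
    calc Chebyshev.theta xs - xs ≤ (b * c₁ + 1) * (xs ^ (-b) * xs * Real.log xs) := hS1
      _ = xs * ((b * c₁ + 1) * (xs ^ (-b) * Real.log xs)) := by ring
      _ ≤ xs * (1 / 2) := h
      _ = xs / 2 := by ring
  have herr : 2 * (Chebyshev.theta xs - xs) ^ 2 / (xs ^ 2 * Real.log xs) ≤
      c₁ * xs ^ (-b) / 2 := by
    rw [div_le_iff₀ (by positivity)]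
    have h1 : (Chebyshev.theta xs - xs) ^ 2 ≤ ((b * c₁ + 1) * (xs ^ (-b) * xs * Real.log xs)) ^ 2 :=
      pow_le_pow_left₀ hS0 hS1 2
    have h3 : 0 ≤ xs ^ (-b) * (xs ^ 2 * Real.log xs) := by positivity
    calc 2 * (Chebyshev.theta xs - xs) ^ 2
        ≤ 2 * ((b * c₁ + 1) * (xs ^ (-b) * xs * Real.log xs)) ^ 2 := by linarith
      _ = 2 * ((b * c₁ + 1) ^ 2 * (xs ^ (-b) * Real.log xs) *
            (xs ^ (-b) * (xs ^ 2 * Real.log xs))) := by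
          ring
      _ ≤ 2 * (c₁ / 4 * (xs ^ (-b) * (xs ^ 2 * Real.log xs))) := by
          have := mul_le_mul_of_nonneg_right hq2 h3
          linarith
      _ = c₁ * xs ^ (-b) / 2 * (xs ^ 2 * Real.log xs) := by ring
  -- conclusion at `xs`
  refine ⟨xs, by linarith, ?_⟩
  have hθ_lower := loglog_ge_of_le hxs1 hlog1 (by linarith : xs ≤ Chebyshev.theta xs)
    (by linarith [hSx])
  have hKu : c₁ * xs ^ (-b) < nicolasK xs - mertensDefect xs := by
    have h1 : mertensDefect xs ≤ u₃ := mertensDefect_mono hxs₃.le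
    have h2 : 0 < nicolasK xs - u₃ - c₁ * xs ^ (-b) := hy_xs
    linarith
  have hKdef : nicolasK xs - mertensDefect xs =
      Real.eulerMascheroniConstant + Real.log (Real.log xs) +
        (Chebyshev.theta xs - xs) / (xs * Real.log xs) - mertensLog xs := by
    simp only [nicolasK, mertensDefect]
    ring
  rw [log_nicolasF_eq (by linarith : (3 : ℝ) ≤ xs)]
  have hcw : c * xs ^ (-b) = c₁ * xs ^ (-b) - c₁ * xs ^ (-b) / 2 := by
    rw [hc₁]
    ring
  rw [hcw]
  linarith [hKdef, hKu, herr, hθ_lower]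

/-! ### The `Ω₋` half (same `b`) and the discharge -/

/-- **Nicolas 1983, Thm. 3 (c), the `Ω₋` half** (for a given right-most zero): with `b`, `s₀`
as above and any real `c`, `log f(x) ≤ -c x^{-b}` for arbitrarily large `x`; from
`exists_nicolasFn_neg_of_zero` and `log f(x) ≤ g(x) - c x^{-b}` (`θ ≤ ψ`, `log_log_psi_le`).
[cite: Nicolas1983, Thm. 3 (c) and §4 Prop. 3] -/
theorem exists_log_nicolasF_le_of_zero {b : ℝ} (hb0 : 0 < b) (hb : b < 1 / 2) {s₀ : ℂ}
    (hZ : zetaOne s₀ = 0) (hre : -b < s₀.re) (hray : ∀ t : ℝ, 0 < t → zetaOne (s₀ + t) ≠ 0)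
    (c X : ℝ) : ∃ x : ℝ, X < x ∧ Real.log (LFunctions.nicolasF x) ≤ -c * x ^ (-b) := by
  obtain ⟨x, hxX, hgx⟩ := exists_nicolasFn_neg_of_zero hb0 hb hZ hre hray c (max X 7)
  have hx7 : 7 ≤ x := le_trans (le_max_right _ _) hxX.le
  refine ⟨x, lt_of_le_of_lt (le_max_left _ _) hxX, ?_⟩
  have hθ1 : 1 < Chebyshev.theta x := LFunctions.one_lt_theta (by linarith)
  have hlogθ : 0 < Real.log (Chebyshev.theta x) := Real.log_pos hθ1
  have hθψ : Real.log (Real.log (Chebyshev.theta x)) ≤ Real.log (Real.log (Chebyshev.psi x)) :=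
    Real.log_le_log hlogθ (Real.log_le_log (by linarith) (Chebyshev.theta_le_psi x))
  have hψ := log_log_psi_le hx7
  have hg : nicolasFn b c x = c * x ^ (-b) + Real.eulerMascheroniConstant +
      Real.log (Real.log x) + psiError x - mertensLog x := rfl
  rw [log_nicolasF_eq (by linarith : (3 : ℝ) ≤ x)]
  linarith

/-- **Nicolas 1983, Thm. 3 (c): `log f(x) = Ω±(x^{-b})` if RH fails, with every constant.**
If the Riemann hypothesis is false there is `b ∈ (0, 1/2)` such that for every `c > 0` both
`log f(x) ≤ -c x^{-b}` and `log f(x) ≥ c x^{-b}` hold for arbitrarily large `x`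
(`f = nicolasF`). (Nicolas states `Ω±(x^{-b})` for every `1 - θ < b < 1/2`, `θ = sup Re ρ`;
the version for every `c` follows from his by decreasing `b`.)
[cite: Nicolas1983, Thm. 3 (c); §4 Prop. 3 and pp. 386–387] -/
theorem Nicolas1983_logf_omega_pm (hRH : ¬ RiemannHypothesis) :
    ∃ b : ℝ, 0 < b ∧ b < 1 / 2 ∧ ∀ c : ℝ, 0 < c →
      (∀ X : ℝ, ∃ x : ℝ, X < x ∧ Real.log (LFunctions.nicolasF x) ≤ -c * x ^ (-b)) ∧
      (∀ X : ℝ, ∃ x : ℝ, X < x ∧ c * x ^ (-b) ≤ Real.log (LFunctions.nicolasF x)) := by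
  obtain ⟨s₀, hZ, hre1, hre2, hray⟩ := exists_zero_right_of_not_RH hRH
  refine ⟨(-s₀.re + 1 / 2) / 2, by linarith, by linarith, fun c hc ↦ ⟨fun X ↦ ?_, fun X ↦ ?_⟩⟩
  · exact exists_log_nicolasF_le_of_zero (by linarith) (by linarith) hZ (by linarith) hray c X
  · exact exists_log_nicolasF_ge_of_zero (by linarith) (by linarith) hZ (by linarith) hray hc X

/-! ### The printed form: every `b` with `1 - Θ < b < 1/2` -/

/-- The right-most zero of `ζ` on the horizontal line through a given zero `ρ` with
`Re ρ > 1/2`: in terms of `s₀ = ρ₀ - 1`, `Z₁(s₀) = 0`, `Re ρ - 1 ≤ Re s₀ < 0`, and `Z₁ ≠ 0` on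
the ray to the right of `s₀` (as in `exists_zero_right_of_not_RH`, keeping track of `Re ρ`;
librarian note: `NicolasOmega.exists_zero_right_of_not_RH` should be re-derived from this
theorem, so that the topic carries one `sSup` argument). [folklore] -/
theorem exists_zero_right_of_zero {ρ : ℂ} (hρ : riemannZeta ρ = 0) (hρ1 : 1 / 2 < ρ.re) :
    ∃ s₀ : ℂ, zetaOne s₀ = 0 ∧ ρ.re - 1 ≤ s₀.re ∧ s₀.re < 0 ∧
      ∀ t : ℝ, 0 < t → zetaOne (s₀ + t) ≠ 0 := by
  have hρ2 : ρ.re < 1 := by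
    by_contra h
    push Not at h
    exact riemannZeta_ne_zero_of_one_le_re h hρ
  have hρim : ρ.im ≠ 0 := Literature.NumberTheory.LFunctions.im_ne_zero_of_riemannZeta_eq_zero hρ (by linarith) hρ2
  set t₀ : ℝ := ρ.im with ht₀
  set S : Set ℝ := Icc ρ.re 1 ∩ {σ : ℝ | riemannZeta (σ + t₀ * Complex.I) = 0} with hS
  have hcont : Continuous fun σ : ℝ ↦ riemannZeta (σ + t₀ * Complex.I) := by
    refine continuous_iff_continuousAt.2 fun σ ↦ ?_
    have hne : (σ : ℂ) + t₀ * Complex.I ≠ 1 := by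
      intro h; have := congrArg Complex.im h; simp at this; exact hρim this
    have hpath : Continuous fun σ : ℝ ↦ (σ : ℂ) + t₀ * Complex.I :=
      Complex.continuous_ofReal.add continuous_const
    exact ContinuousAt.comp (f := fun σ : ℝ ↦ (σ : ℂ) + t₀ * Complex.I)
      (differentiableAt_riemannZeta hne).continuousAt hpath.continuousAt
  have hSc : IsClosed S := isClosed_Icc.inter (isClosed_eq hcont continuous_const)
  have hρS : ρ.re ∈ S := by
    refine ⟨⟨le_rfl, hρ2.le⟩, ?_⟩
    show riemannZeta (↑ρ.re + ↑t₀ * Complex.I) = 0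
    rw [ht₀, Complex.re_add_im]
    exact hρ
  have hSne : S.Nonempty := ⟨_, hρS⟩
  have hSbdd : BddAbove S := ⟨1, fun σ hσ ↦ hσ.1.2⟩
  set σ₀ : ℝ := sSup S with hσ₀
  have hσ₀S : σ₀ ∈ S := hSc.csSup_mem hSne hSbdd
  have hσ₀ρ : ρ.re ≤ σ₀ := le_csSup hSbdd hρS
  have hσ₀1 : σ₀ ≤ 1 := hσ₀S.1.2
  have hζσ₀ : riemannZeta (σ₀ + t₀ * Complex.I) = 0 := hσ₀S.2
  have hσ₀1' : σ₀ < 1 := by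
    rcases hσ₀1.lt_or_eq with h | h
    · exact h
    · exfalso
      refine riemannZeta_ne_zero_of_one_le_re (s := σ₀ + t₀ * Complex.I) ?_ hζσ₀
      simp [h]
  refine ⟨σ₀ + t₀ * Complex.I - 1, ?_, ?_, ?_, ?_⟩
  · rw [zetaOne_eq_zero_iff]
    refine ⟨?_, by rwa [add_sub_cancel]⟩
    intro h; have := congrArg Complex.im h; simp at this; exact hρim this
  · simp; linarith
  · simp; linarith
  · intro t ht hzero
    rw [zetaOne_eq_zero_iff] at hzero
    obtain ⟨-, hζ⟩ := hzero
    have heq : 1 + (↑σ₀ + ↑t₀ * Complex.I - 1 + ↑t) = ((σ₀ + t : ℝ) : ℂ) + t₀ * Complex.I := by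
      push_cast; ring
    rw [heq] at hζ
    by_cases hle : σ₀ + t ≤ 1
    · have hmem : σ₀ + t ∈ S := ⟨⟨by linarith, hle⟩, hζ⟩
      have := le_csSup hSbdd hmem
      linarith
    · exact riemannZeta_ne_zero_of_one_le_re (s := ((σ₀ + t : ℝ) : ℂ) + t₀ * Complex.I)
        (by simp; linarith) hζ

/-- **Nicolas 1983, Thm. 3 (c), as printed**: "si l'on désigne par `Θ` la borne supérieure des
parties réelles des zéros de `ζ`, alors, pour tout `b` vérifiant `1 - Θ < b < 1/2`, on a
`log f(x) = Ω±(x^{-b})`". Stated without naming `Θ`: for every `b < 1/2` and every zero `ρ` of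
`ζ` with `Re ρ > 1 - b` (such a zero exists iff `1 - Θ < b`), and every `c > 0`, both
`log f(x) ≤ -c x^{-b}` and `log f(x) ≥ c x^{-b}` hold for arbitrarily large `x`. (Here `b > 0`
automatically, since `Re ρ < 1`; Nicolas's `Ω±` carries some constant `c > 0`, the version
for every `c` follows from his by decreasing `b`.)
[cite: Nicolas1983, Thm. 3 (c) (p. 376); §4 Prop. 3 and pp. 386–387] -/
theorem Nicolas1983_thm3c {b : ℝ} (hb : b < 1 / 2) {ρ : ℂ} (hρ : riemannZeta ρ = 0)
    (hbρ : 1 - b < ρ.re) {c : ℝ} (hc : 0 < c) (X : ℝ) :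
    (∃ x : ℝ, X < x ∧ Real.log (LFunctions.nicolasF x) ≤ -c * x ^ (-b)) ∧
      (∃ x : ℝ, X < x ∧ c * x ^ (-b) ≤ Real.log (LFunctions.nicolasF x)) := by
  obtain ⟨s₀, hZ, hre1, hre2, hray⟩ := exists_zero_right_of_zero hρ (by linarith)
  have hρ2 : ρ.re < 1 := by
    by_contra h
    push Not at h
    exact riemannZeta_ne_zero_of_one_le_re h hρ
  have hb0 : 0 < b := by linarith
  exact ⟨exists_log_nicolasF_le_of_zero hb0 hb hZ (by linarith) hray c X,
    exists_log_nicolasF_ge_of_zero hb0 hb hZ (by linarith) hray hc X⟩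

/-! ### Nicolas's Theorem 2 (b): `N_k/φ(N_k)` against `e^γ log log N_k` at the primorials -/

/-- **Sign changes of `f - 1`** (Nicolas 1983, Thm. 3 (c), first sentence): if the Riemann
hypothesis is false, `f(x) < 1` for arbitrarily large `x` and `f(x) > 1` for arbitrarily large
`x`. [cite: Nicolas1983, Thm. 3 (c) (p. 376)] -/
theorem Nicolas1983_thm3c_sign (hRH : ¬ RiemannHypothesis) :
    (∀ X : ℝ, ∃ x : ℝ, X < x ∧ LFunctions.nicolasF x < 1) ∧
      (∀ X : ℝ, ∃ x : ℝ, X < x ∧ 1 < LFunctions.nicolasF x) := by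
  obtain ⟨b, hb0, -, h⟩ := Nicolas1983_logf_omega_pm hRH
  obtain ⟨hminus, hplus⟩ := h 1 one_pos
  constructor
  · intro X
    obtain ⟨x, hx, hle⟩ := hminus (max X 3)
    have hx3 : 3 ≤ x := le_trans (le_max_right _ _) hx.le
    refine ⟨x, lt_of_le_of_lt (le_max_left _ _) hx, ?_⟩
    have hf := LFunctions.nicolasF_pos hx3
    have hw : 0 < x ^ (-b) := Real.rpow_pos_of_pos (by linarith) _
    have hlog : Real.log (LFunctions.nicolasF x) < 0 := by linarith
    exact (Real.log_neg_iff hf).1 hlog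
  · intro X
    obtain ⟨x, hx, hle⟩ := hplus (max X 3)
    have hx3 : 3 ≤ x := le_trans (le_max_right _ _) hx.le
    refine ⟨x, lt_of_le_of_lt (le_max_left _ _) hx, ?_⟩
    have hf := LFunctions.nicolasF_pos hx3
    have hw : 0 < x ^ (-b) := Real.rpow_pos_of_pos (by linarith) _
    have hlog : 0 < Real.log (LFunctions.nicolasF x) := by linarith
    exact (Real.log_pos_iff hf.le).1 hlog

/-- `f` is a step function, constant between consecutive primes: for `x ≥ 2` there is a prime
`p ≤ x` with `p > (x - 1)/2` (Bertrand) and `f(p) = f(x)` (namely the largest prime `p ≤ x`).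
[folklore] -/
theorem exists_prime_nicolasF_eq {x : ℝ} (hx : 2 ≤ x) :
    ∃ p : ℕ, p.Prime ∧ (x - 1) / 2 < p ∧ (p : ℝ) ≤ x ∧ LFunctions.nicolasF p = LFunctions.nicolasF x := by
  have hx0 : 0 ≤ x := by linarith
  have hn2 : 2 ≤ ⌊x⌋₊ := Nat.le_floor (by exact_mod_cast hx)
  have hnx : (⌊x⌋₊ : ℝ) ≤ x := Nat.floor_le hx0
  have hxn : x < ⌊x⌋₊ + 1 := Nat.lt_floor_add_one x
  have hne : (Nat.primesLE ⌊x⌋₊).Nonempty := ⟨2, Nat.mem_primesLE.2 ⟨hn2, Nat.prime_two⟩⟩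
  obtain ⟨p, hp⟩ : ∃ p : ℕ, p = (Nat.primesLE ⌊x⌋₊).max' hne := ⟨_, rfl⟩
  have hpmem : p ∈ Nat.primesLE ⌊x⌋₊ := hp ▸ Finset.max'_mem _ hne
  have hpprime : p.Prime := Nat.prime_of_mem_primesLE hpmem
  have hpn : p ≤ ⌊x⌋₊ := Nat.le_of_mem_primesLE hpmem
  have hmax : ∀ q ∈ Nat.primesLE ⌊x⌋₊, q ≤ p := fun q hq ↦ hp ▸ Finset.le_max' _ q hq
  have hset : Nat.primesLE p = Nat.primesLE ⌊x⌋₊ := by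
    ext q
    simp only [Nat.mem_primesLE]
    constructor
    · exact fun h ↦ ⟨h.1.trans hpn, h.2⟩
    · exact fun h ↦ ⟨hmax q (Nat.mem_primesLE.2 h), h.2⟩
  -- Bertrand: a prime in `(n/2, n]`, hence `p > n/2`
  obtain ⟨q, hq, hq1, hq2⟩ := Nat.exists_prime_lt_and_le_two_mul (⌊x⌋₊ / 2) (by omega)
  have hqn : q ≤ ⌊x⌋₊ := le_trans hq2 (by omega)
  have hqp : q ≤ p := hmax q (Nat.mem_primesLE.2 ⟨hqn, hq⟩)
  have hp2 : ⌊x⌋₊ ≤ 2 * p := by omega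
  refine ⟨p, hpprime, ?_, le_trans (by exact_mod_cast hpn) hnx, ?_⟩
  · have : (⌊x⌋₊ : ℝ) ≤ 2 * p := by exact_mod_cast hp2
    linarith
  · simp only [LFunctions.nicolasF, Nat.floor_natCast, Chebyshev.theta_eq_sum_primesLE, hset]

/-- `f` at an integer `m`, in terms of the primorial `N = m#` (`log N = θ(m)`, Euler's product
for `φ`): `f(m) = e^γ log log N · φ(N)/N`. [cite: Nicolas1983, §1 (Thm. 2 ⟸ Thm. 3)] -/
theorem nicolasF_natCast_eq (m : ℕ) :
    LFunctions.nicolasF m = Real.exp Real.eulerMascheroniConstant *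
      Real.log (Real.log (primorial m)) * ((Nat.totient (primorial m) : ℝ) / primorial m) := by
  have hN : primorial m = ∏ p ∈ Nat.primesLE m, p := by
    unfold primorial
    congr 1
  have hpf : (primorial m).primeFactors = Nat.primesLE m := by
    rw [hN]
    exact Nat.primeFactors_prod fun p hp ↦ Nat.prime_of_mem_primesLE hp
  have hφ := Nat.totient_eq_mul_prod_factors (primorial m)
  have hφR : (Nat.totient (primorial m) : ℝ) =
      (primorial m : ℝ) * ∏ p ∈ Nat.primesLE m, (1 - (p : ℝ)⁻¹) := by
    have := congrArg (Rat.cast : ℚ → ℝ) hφ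
    push_cast at this
    rw [hpf] at this
    exact this
  have hN0 : (primorial m : ℝ) ≠ 0 := by exact_mod_cast (primorial_pos m).ne'
  rw [LFunctions.nicolasF, Nat.floor_natCast, Chebyshev.theta_eq_log_primorial, Nat.floor_natCast, hφR,
    mul_div_cancel_left₀ _ hN0]

/-- **Nicolas 1983, Thm. 2 (b).** Let `N_k = 2 · 3 ⋯ p_k` be the product of the first `k`
primes. If the Riemann hypothesis is false, `N_k/φ(N_k) > e^γ log log N_k` holds for infinitely
many `k` and fails for infinitely many `k`. Stated over the primes `p = p_k` (`N_k = p#`,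
`k ↦ p_k` a bijection onto the primes, so "infinitely many `k`" is "for arbitrarily large primes
`p`"), with the failure in the strict form `N/φ(N) < e^γ log log N` which the proof gives.
From Thm. 3 (c) (`Nicolas1983_thm3c_sign`): `f(p) < 1 ⟺ e^γ log log N < N/φ(N)` for `N = p#`
(`nicolasF_natCast_eq`), and `f` is constant between consecutive primes.
[cite: Nicolas1983, Thm. 2 (b) (p. 376) and §1 (deduction from Thm. 3)] -/
theorem Nicolas1983_thm2b (hRH : ¬ RiemannHypothesis) :
    (∀ X : ℝ, ∃ p : ℕ, p.Prime ∧ X < p ∧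
      Real.exp Real.eulerMascheroniConstant * Real.log (Real.log (primorial p)) <
        (primorial p : ℝ) / Nat.totient (primorial p)) ∧
    (∀ X : ℝ, ∃ p : ℕ, p.Prime ∧ X < p ∧
      (primorial p : ℝ) / Nat.totient (primorial p) <
        Real.exp Real.eulerMascheroniConstant * Real.log (Real.log (primorial p))) := by
  obtain ⟨hlt, hgt⟩ := Nicolas1983_thm3c_sign hRH
  -- the common transfer step
  have key : ∀ p : ℕ, p.Prime →
      (LFunctions.nicolasF p < 1 ↔ Real.exp Real.eulerMascheroniConstant *
        Real.log (Real.log (primorial p)) < (primorial p : ℝ) / Nat.totient (primorial p)) ∧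
      (1 < LFunctions.nicolasF p ↔ (primorial p : ℝ) / Nat.totient (primorial p) <
        Real.exp Real.eulerMascheroniConstant * Real.log (Real.log (primorial p))) := by
    intro p hp
    have hN0 : (0 : ℝ) < primorial p := by exact_mod_cast primorial_pos p
    have hφ0 : (0 : ℝ) < Nat.totient (primorial p) := by
      exact_mod_cast Nat.totient_pos.2 (primorial_pos p)
    have hr : 0 < (Nat.totient (primorial p) : ℝ) / primorial p := div_pos hφ0 hN0
    have h1 : (primorial p : ℝ) / Nat.totient (primorial p) =
        1 / ((Nat.totient (primorial p) : ℝ) / primorial p) := (one_div_div _ _).symm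
    rw [nicolasF_natCast_eq, h1]
    constructor
    · rw [lt_div_iff₀ hr]
    · rw [div_lt_iff₀ hr]
  constructor
  · intro X
    obtain ⟨x, hx, hfx⟩ := hlt (max (2 * X + 1) 2)
    have hx2 : 2 ≤ x := le_trans (le_max_right _ _) hx.le
    obtain ⟨p, hp, hpx, -, hfp⟩ := exists_prime_nicolasF_eq hx2
    refine ⟨p, hp, ?_, ((key p hp).1).1 (by rwa [hfp])⟩
    have : 2 * X + 1 < x := lt_of_le_of_lt (le_max_left _ _) hx
    linarith
  · intro X
    obtain ⟨x, hx, hfx⟩ := hgt (max (2 * X + 1) 2)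
    have hx2 : 2 ≤ x := le_trans (le_max_right _ _) hx.le
    obtain ⟨p, hp, hpx, -, hfp⟩ := exists_prime_nicolasF_eq hx2
    refine ⟨p, hp, ?_, ((key p hp).2).1 (by rwa [hfp])⟩
    have : 2 * X + 1 < x := lt_of_le_of_lt (le_max_left _ _) hx
    linarith

end Nicolas

section RH

open Nicolas

/-- **Discharge of the named fact `Nicolas1983_logf_omega`** (`NicolasMertensRH.lean`;
Nicolas 1983, Thm. 3 (c), as restated in Nicolas 2012, (1.10)): if the Riemann hypothesis
fails, there is `b ∈ (0, 1/2)` with `log f(x) = Ω₋(x^{-b})` and `log f(x) = Ω₊(x^{-b})`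
(here with `c = 1` in both). From `Nicolas1983_logf_omega_pm`.
[cite: Nicolas1983, Thm. 3 (c); §4 Prop. 3 and pp. 386–387]
[cite: Nicolas2012, (1.10)] -/
theorem Nicolas1983_logf_omega_holds : Nicolas1983_logf_omega := by
  intro hRH
  obtain ⟨b, hb0, hb, h⟩ := Nicolas1983_logf_omega_pm hRH
  obtain ⟨hminus, hplus⟩ := h 1 one_pos
  refine ⟨b, hb0, hb, ⟨1, one_pos, ?_⟩, ⟨1, one_pos, ?_⟩⟩
  · rw [Filter.frequently_atTop]
    intro X
    obtain ⟨x, hx, h⟩ := hminus X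
    exact ⟨x, hx.le, h⟩
  · rw [Filter.frequently_atTop]
    intro X
    obtain ⟨x, hx, h⟩ := hplus X
    exact ⟨x, hx.le, by simpa using h⟩

end RH

end Literature.NumberTheory.LFunctions
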